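import Summits.AtomisticToContinuum.Crystallization.Theorems.RadialDefectsVanish.Negative.FalseWithoutGS
import Summits.AtomisticToContinuum.Crystallization.Theorems.ChargedEnergyGap.Negative.Unconditional
import Summits.AtomisticToContinuum.Crystallization.Theorems.SlackRigidity.Negative.WitnessBasics
import Literature.MathematicalPhysics.StatisticalMechanics.LennardJonesClusters

/-!
# Crux `GappedShellCensus.RadialDefectsVanish` (stmt-AtomisticToContinuum-15930) — negative lemmas, gen 2:
# minimality is load-bearing (I: the zero potential; `κ`-near ground states; the mixture witness)

Crux disprover (cdisprove gen 2); dossier `Cruxes/RadialDefectsVanish/Disproof.lean` §3, §6.  This file: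
* `not_radialDefectsVanishFor_zero` — the crux with `V_LJ` replaced by the ZERO potential is FALSE
  (every injective configuration is a ground state of `0`; the dilated line is all-bad).
* `IsNearGroundState κ` (`E(x) ≤ (1 − κ)·E(N)`, injective) and `RadialDefectsVanishNear κ`, with
  `radialDefectsVanishNear_zero_iff : RadialDefectsVanishNear 0 ↔ RadialDefectsVanish` and
  `RadialDefectsVanishNear.anti` (antitone in `κ`).
* `lennardJones_mul_le : V_LJ(λr) ≤ λ⁻⁶ V_LJ(r)` (`λ ≥ 1`), `interactionEnergy_smul_le`.
* The WITNESS against `RadialDefectsVanishNear κ`, `κ > 0`: `w` / `mix K M` = `K` far-apart copies of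
  a ground state (`SlackRigidityNegative.gs`) of `⌊M/(K+1)⌋` particles plus one copy dilated by `21/20`
  plus isolated extras
  (geometry: `two_le_dist_w`, `dist_w_inl_inl`, `w_injective`); `GoodAt` (gapped-twelve on any finite
  index type, `= IsGappedTwelveAt` on `Fin N` by `Iff.rfl`); `wit` (the mixture once `κ`-near, a ground
  state before).  Energy and counting: `…Negative.NearGroundStatesEnergy`; the refutation
  `not_radialDefectsVanishNear`: `…Negative.NearGroundStatesRefuted`.
-/

noncomputable section

open scoped Classical
open Filter
open Literature.MathematicalPhysics.StatisticalMechanics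
open Summit.AtomisticToContinuum.Crystallization.Theses.GappedShellCensus
open Summit.AtomisticToContinuum.Crystallization.Theorems.ChargedEnergyGapNegative (eStar card_mul_eStar_le
  crysEnergyLimit eStar_le_groundStateEnergy_div e0 norm_e0 e0_ne_zero dimer dimer_injective
  interactionEnergy_dimer groundStateEnergy_nonpos)
open Summit.AtomisticToContinuum.Crystallization.Theorems.SlackRigidityNegative (gs gs_isGroundState)

namespace Summit.AtomisticToContinuum.Crystallization.Theorems.RadialDefectsVanish.Negative

local notation "E3" => EuclideanSpace ℝ (Fin 3)


/-- The crux with the pair potential as a parameter (`RadialDefectsVanishFor lennardJones` is the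
route decl, `Iff.rfl`). -/
def RadialDefectsVanishFor (V : ℝ → ℝ) : Prop :=
  ∀ x : (N : ℕ) → (Fin N → E3), (∀ N, IsGroundState V (x N)) → RadialConclusion x

/-- Read-back: at `V = V_LJ` this is the route decl. -/
theorem radialDefectsVanishFor_lennardJones_iff :
    RadialDefectsVanishFor lennardJones ↔ RadialDefectsVanish := Iff.rfl

/-- The conclusion of the crux fails for the dilated line `i ↦ 2i·e₀` (every site is bad at every
scale `a ≤ 1`; the argument of `radialDefectsVanish_false_without_GS`, factored). [folklore] -/
theorem not_radialConclusion_dilatedLine : ¬ RadialConclusion dilatedLine := by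
  rintro ⟨a, -, ha1, hθ⟩
  have hhalf := hθ (1 / 2) (by norm_num)
  rw [Filter.frequently_atTop] at hhalf
  obtain ⟨N, hN1, hN⟩ := hhalf 1
  have hcardN : Nat.card {i : Fin N // ¬ IsGappedTwelveAt dilatedLine a N i} = N := by
    rw [Nat.card_congr (Equiv.subtypeUnivEquiv fun i => not_isGappedTwelveAt_dilatedLine ha1 N i),
      Nat.card_eq_fintype_card, Fintype.card_fin]
  rw [hcardN] at hN
  have hN1' : (1 : ℝ) ≤ N := by exact_mod_cast hN1
  linarith

/-- The dilated line is injective. [folklore] -/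
theorem dilatedLine_injective (N : ℕ) : Function.Injective (dilatedLine N) := by
  intro i j h
  by_contra hne
  have h2 := two_le_dist_dilatedLine N (Ne.symm hne)
  rw [h, dist_self] at h2
  norm_num at h2

/-- **The crux for the zero potential is FALSE**: every injective configuration is a ground state of
`V = 0` (`isGroundState_zero`), in particular the dilated line.  So a proof of `RadialDefectsVanish`
must use the Lennard-Jones well quantitatively — injectivity + minimality ALONE (the formal content
of `IsGroundState`) force no radial order. [folklore] -/
theorem not_radialDefectsVanishFor_zero : ¬ RadialDefectsVanishFor fun _ => 0 := fun h =>
  not_radialConclusion_dilatedLine (h dilatedLine fun N => isGroundState_zero (dilatedLine_injective N))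

/-- `κ`-near ground state: distinct points whose energy is within the FRACTION `κ` of the optimal
binding, `E(x) ≤ (1 − κ)·E(N)` (recall `E(N) ≤ 0`); at `κ = 0` this is `IsGroundState V_LJ`. -/
def IsNearGroundState (κ : ℝ) {N : ℕ} (x : Fin N → E3) : Prop :=
  Function.Injective x ∧
    interactionEnergy lennardJones x ≤ (1 - κ) * groundStateEnergy lennardJones 3 N

/-- The crux for sequences of `κ`-near ground states (`κ = 0`: the crux). -/
def RadialDefectsVanishNear (κ : ℝ) : Prop :=
  ∀ x : (N : ℕ) → (Fin N → E3), (∀ N, IsNearGroundState κ (x N)) → RadialConclusion x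

/-- At `κ = 0`, near ground states are exactly ground states (`E(N) ≤ E(x)` always). [folklore] -/
theorem isNearGroundState_zero_iff {N : ℕ} {x : Fin N → E3} :
    IsNearGroundState 0 x ↔ IsGroundState lennardJones x := by
  constructor
  · rintro ⟨hx, hE⟩
    exact ⟨hx, le_antisymm (by simpa using hE) (groundStateEnergy_lennardJones_le hx)⟩
  · rintro ⟨hx, hE⟩
    exact ⟨hx, by rw [hE]; simp⟩

/-- Monotonicity in `κ` (uses `E(N) ≤ 0`). [folklore] -/
theorem IsNearGroundState.of_le {κ κ' : ℝ} (h : κ ≤ κ') {N : ℕ} {x : Fin N → E3}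
    (hx : IsNearGroundState κ x) : IsNearGroundState κ' x :=
  ⟨hx.1, hx.2.trans (mul_le_mul_of_nonpos_right (by linarith) (groundStateEnergy_nonpos N))⟩

/-- Ground states are `κ`-near for every `κ ≥ 0`. [folklore] -/
theorem isNearGroundState_of_isGroundState {κ : ℝ} (hκ : 0 ≤ κ) {N : ℕ} {x : Fin N → E3}
    (hx : IsGroundState lennardJones x) : IsNearGroundState κ x :=
  (isNearGroundState_zero_iff.2 hx).of_le hκ

/-- At `κ = 0` the near-ground-state crux IS the route decl. -/
theorem radialDefectsVanishNear_zero_iff : RadialDefectsVanishNear 0 ↔ RadialDefectsVanish := by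
  rw [radialDefectsVanish_iff]
  unfold RadialDefectsVanishNear
  simp only [isNearGroundState_zero_iff]

/-- The family is antitone in `κ`. -/
theorem RadialDefectsVanishNear.anti {κ κ' : ℝ} (h : κ ≤ κ') (H : RadialDefectsVanishNear κ') :
    RadialDefectsVanishNear κ := fun x hx => H x fun N => (hx N).of_le h

/-- `V_LJ(λ r) ≤ λ⁻⁶ V_LJ(r)` for `λ ≥ 1`: the attraction scales exactly by `λ⁻⁶`, the repulsion by
`λ⁻¹² ≤ λ⁻⁶`. [folklore] -/
theorem lennardJones_mul_le {l r : ℝ} (hl : 1 ≤ l) (hr : 0 ≤ r) :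
    lennardJones (l * r) ≤ l⁻¹ ^ 6 * lennardJones r := by
  unfold lennardJones
  rw [mul_inv, mul_pow, mul_pow]
  have hm0 : 0 ≤ l⁻¹ := inv_nonneg.2 (by linarith)
  have hm1 : l⁻¹ ≤ 1 := inv_le_one_of_one_le₀ hl
  have hu : 0 ≤ r⁻¹ := inv_nonneg.2 hr
  have h6 : l⁻¹ ^ 6 ≤ 1 := pow_le_one₀ hm0 hm1
  have h6' : 0 ≤ l⁻¹ ^ 6 := pow_nonneg hm0 6
  have h12 : l⁻¹ ^ 12 = l⁻¹ ^ 6 * l⁻¹ ^ 6 := by ring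
  have hu12 : 0 ≤ r⁻¹ ^ 12 := pow_nonneg hu 12
  have key : 0 ≤ l⁻¹ ^ 6 * (1 - l⁻¹ ^ 6) * r⁻¹ ^ 12 :=
    mul_nonneg (mul_nonneg h6' (by linarith)) hu12
  nlinarith [key, h12]

/-- Hence `E_LJ(λ x) ≤ λ⁻⁶ E_LJ(x)` for every finite configuration and `λ ≥ 1`. [folklore] -/
theorem interactionEnergy_smul_le {N : ℕ} (x : Fin N → E3) {l : ℝ} (hl : 1 ≤ l) :
    interactionEnergy lennardJones (fun i => l • x i) ≤ l⁻¹ ^ 6 * interactionEnergy lennardJones x := by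
  unfold interactionEnergy
  rw [Finset.mul_sum]
  refine Finset.sum_le_sum fun i _ => ?_
  rw [Finset.mul_sum]
  refine Finset.sum_le_sum fun j _ => ?_
  rw [dist_smul₀, Real.norm_of_nonneg (by linarith : (0:ℝ) ≤ l)]
  exact lennardJones_mul_le hl dist_nonneg

/-- The dilation factor `21/20`: scales `a` and `(20/21)·a` are exclusive (`0.98·21/20 = 1.029 > 1.02`,
`1.02·21/20 = 1.071 < 1.26`). -/
def dil : ℝ := 21 / 20

/-- Shift length between consecutive slots: `2·(21/20)·Σ‖x_k‖ + 2`. -/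
def shiftLen (N : ℕ) : ℝ := 2 * (dil * ∑ k, ‖gs N k‖) + 2

/-- Index type of the mixture: `K+1` copies of `Fin N` and `r` isolated extras. -/
abbrev Idx (K N r : ℕ) := (Fin (K + 1) × Fin N) ⊕ Fin r

/-- Dilation factor of copy `q`: `21/20` for the last copy, `1` otherwise. -/
def scale (K : ℕ) (q : Fin (K + 1)) : ℝ := if (q : ℕ) = K then dil else 1

/-- Slot number along the `e₀`-axis. -/
def slot {K N r : ℕ} : Idx K N r → ℕ := Sum.elim (fun p => (p.1 : ℕ)) (fun t => K + 1 + (t : ℕ))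

/-- Position inside the slot. -/
def off {K N r : ℕ} : Idx K N r → E3 := Sum.elim (fun p => scale K p.1 • gs N p.2) (fun _ => 0)

/-- The mixture, indexed by `Idx`. -/
def w (K N r : ℕ) (α : Idx K N r) : E3 := off α + ((slot α : ℕ) : ℝ) • (shiftLen N • e0)

/-- `1 ≤ 21/20`. [folklore] -/
theorem one_le_dil : (1 : ℝ) ≤ dil := by norm_num [dil]

/-- Every copy is dilated by a factor `≥ 1`. [folklore] -/
theorem one_le_scale (K : ℕ) (q : Fin (K + 1)) : 1 ≤ scale K q := by
  unfold scale; split_ifs <;> norm_num [dil]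

/-- Dilation factors are positive. [folklore] -/
theorem scale_pos (K : ℕ) (q : Fin (K + 1)) : 0 < scale K q := one_pos.trans_le (one_le_scale K q)

/-- Dilation factors are `≤ 21/20`. [folklore] -/
theorem scale_le_dil (K : ℕ) (q : Fin (K + 1)) : scale K q ≤ dil := by
  unfold scale; split_ifs <;> norm_num [dil]

/-- The last copy is the dilated one. [folklore] -/
theorem scale_last (K : ℕ) : scale K (Fin.last K) = dil := by simp [scale]

/-- The first `K` copies are undilated. [folklore] -/
theorem scale_castSucc (K : ℕ) (q : Fin K) : scale K q.castSucc = 1 := by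
  simp [scale, ne_of_lt q.2]

/-- `0 ≤ Σ‖x_k‖`. [folklore] -/
theorem sum_norm_nonneg (N : ℕ) : 0 ≤ ∑ k, ‖gs N k‖ := Finset.sum_nonneg fun _ _ => norm_nonneg _

/-- The shift length is positive. [folklore] -/
theorem shiftLen_pos (N : ℕ) : 0 < shiftLen N := by
  unfold shiftLen; have := sum_norm_nonneg N; nlinarith [one_le_dil]

/-- In-slot positions have norm `≤ (21/20)·Σ‖x_k‖`. [folklore] -/
theorem norm_off_le {K N r : ℕ} (α : Idx K N r) : ‖off α‖ ≤ dil * ∑ k, ‖gs N k‖ := by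
  rcases α with ⟨q, s⟩ | t
  · simp only [off, Sum.elim_inl, norm_smul, Real.norm_of_nonneg (scale_pos K q).le]
    have hs : ‖gs N s‖ ≤ ∑ k, ‖gs N k‖ :=
      Finset.single_le_sum (f := fun k => ‖gs N k‖) (fun _ _ => norm_nonneg _) (Finset.mem_univ s)
    have := scale_le_dil K q
    have h0 := (scale_pos K q).le
    nlinarith [norm_nonneg (gs N s)]
  · simp only [off, Sum.elim_inr, norm_zero]
    exact mul_nonneg (by norm_num [dil]) (sum_norm_nonneg N)

/-- Points in different slots are at distance `≥ 2`. -/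
theorem two_le_dist_w {K N r : ℕ} {α β : Idx K N r} (h : slot α ≠ slot β) :
    2 ≤ dist (w K N r α) (w K N r β) := by
  have hL := shiftLen_pos N
  have h1 : (1 : ℝ) ≤ |((slot α : ℕ) : ℝ) - ((slot β : ℕ) : ℝ)| := by
    rcases lt_or_gt_of_ne h with hlt | hgt
    · have : ((slot α : ℕ) : ℝ) + 1 ≤ ((slot β : ℕ) : ℝ) := by exact_mod_cast hlt
      rw [abs_sub_comm, abs_of_pos (by linarith)]; linarith
    · have : ((slot β : ℕ) : ℝ) + 1 ≤ ((slot α : ℕ) : ℝ) := by exact_mod_cast hgt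
      rw [abs_of_pos (by linarith)]; linarith
  have hdecomp : w K N r α - w K N r β =
      (((slot α : ℕ) : ℝ) - ((slot β : ℕ) : ℝ)) • (shiftLen N • e0) + (off α - off β) := by
    simp only [w, sub_smul]; abel
  have hmain : |((slot α : ℕ) : ℝ) - ((slot β : ℕ) : ℝ)| * shiftLen N - (‖off α‖ + ‖off β‖) ≤
      ‖w K N r α - w K N r β‖ := by
    rw [hdecomp]
    have hn : ‖(((slot α : ℕ) : ℝ) - ((slot β : ℕ) : ℝ)) • (shiftLen N • e0)‖ =
        |((slot α : ℕ) : ℝ) - ((slot β : ℕ) : ℝ)| * shiftLen N := by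
      rw [norm_smul, norm_smul, norm_e0, mul_one, Real.norm_eq_abs, Real.norm_of_nonneg hL.le]
    have := norm_sub_norm_le ((((slot α : ℕ) : ℝ) - ((slot β : ℕ) : ℝ)) • (shiftLen N • e0))
      (-(off α - off β))
    rw [sub_neg_eq_add, norm_neg, hn] at this
    linarith [norm_sub_le (off α) (off β)]
  rw [dist_eq_norm]
  have hα := norm_off_le α
  have hβ := norm_off_le β
  have hS : shiftLen N = 2 * (dil * ∑ k, ‖gs N k‖) + 2 := rfl
  nlinarith [hmain, h1, hα, hβ, hL]

/-- Inside one copy the distances are the dilated ground-state distances. -/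
theorem dist_w_inl_inl {K N r : ℕ} (q : Fin (K + 1)) (s s' : Fin N) :
    dist (w K N r (Sum.inl (q, s))) (w K N r (Sum.inl (q, s'))) = scale K q * dist (gs N s) (gs N s') := by
  simp only [w, off, slot, Sum.elim_inl, dist_add_right, dist_smul₀,
    Real.norm_of_nonneg (scale_pos K q).le]

/-- Slot of a copy point. [folklore] -/
theorem slot_inl {K N r : ℕ} (q : Fin (K + 1)) (s : Fin N) : slot (Sum.inl (q, s) : Idx K N r) = q := rfl

/-- Slot of an isolated extra. [folklore] -/
theorem slot_inr {K N r : ℕ} (t : Fin r) : slot (Sum.inr t : Idx K N r) = K + 1 + t := rfl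

/-- The mixture has distinct points. -/
theorem w_injective (K N r : ℕ) : Function.Injective (w K N r) := by
  intro α β hαβ
  by_contra hne
  by_cases hs : slot α = slot β
  · rcases α with ⟨q, s⟩ | t <;> rcases β with ⟨q', s'⟩ | t'
    · simp only [slot_inl] at hs
      have hq : q = q' := Fin.ext hs
      subst hq
      have hd := dist_w_inl_inl (K := K) (N := N) (r := r) q s s'
      rw [hαβ, dist_self] at hd
      have hss : dist (gs N s) (gs N s') = 0 := by
        have := scale_pos K q
        have h0 : scale K q * dist (gs N s) (gs N s') = 0 := hd.symm
        rcases mul_eq_zero.1 h0 with h | h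
        · linarith
        · exact h
      rw [dist_eq_zero] at hss
      exact hne (by rw [(gs_isGroundState N).1 hss])
    · simp only [slot_inl, slot_inr] at hs
      have := q.2; omega
    · simp only [slot_inl, slot_inr] at hs
      have := q'.2; omega
    · simp only [slot_inr] at hs
      exact hne (by rw [Fin.ext (by omega : (t : ℕ) = t')])
  · have h2 := two_le_dist_w (K := K) (N := N) (r := r) hs
    rw [hαβ, dist_self] at h2
    norm_num at h2


/-- Block size `N = ⌊M/(K+1)⌋`. -/
def nBlk (K M : ℕ) : ℕ := M / (K + 1)

/-- Number of isolated extras `r = M mod (K+1)`. -/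
def nRem (K M : ℕ) : ℕ := M % (K + 1)

/-- `M = (K+1)·⌊M/(K+1)⌋ + M mod (K+1)`. [folklore] -/
theorem nBlk_spec (K M : ℕ) : M = (K + 1) * nBlk K M + nRem K M :=
  (Nat.div_add_mod M (K + 1)).symm

/-- `Fin M ≃ (Fin (K+1) × Fin N) ⊕ Fin r`. -/
def idxEquiv (K M : ℕ) : Fin M ≃ Idx K (nBlk K M) (nRem K M) :=
  (finCongr (nBlk_spec K M)).trans
    (finSumFinEquiv.symm.trans (Equiv.sumCongr finProdFinEquiv.symm (Equiv.refl _)))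

/-- **The witness configuration of `M` particles**: `K` far-apart copies of the ground state of
`⌊M/(K+1)⌋` particles, one more copy dilated by `21/20`, and `M mod (K+1)` isolated particles. -/
def mix (K M : ℕ) : Fin M → E3 := w K (nBlk K M) (nRem K M) ∘ idxEquiv K M

/-- The witness has distinct points. [folklore] -/
theorem mix_injective (K M : ℕ) : Function.Injective (mix K M) :=
  (w_injective K _ _).comp (idxEquiv K M).injective

/-- Gapped-twelve at scale `a`, for a configuration on any finite index type (at `ι = Fin N` this is
`IsGappedTwelveAt` by `Iff.rfl`). -/
def GoodAt (a : ℝ) {ι : Type*} [Fintype ι] [DecidableEq ι] (v : ι → E3) (α : ι) : Prop :=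
  (Finset.univ.filter fun β : ι => β ≠ α ∧ dist (v α) (v β) ≤ a * (1 + 1 / 50)).card = 12 ∧
    ∀ β : ι, β ≠ α → a * (1 - 1 / 50) ≤ dist (v α) (v β) ∧
      (dist (v α) (v β) ≤ a * (1 + 1 / 50) ∨ a * (63 / 50) ≤ dist (v α) (v β))

/-- Read-back: `IsGappedTwelveAt` is `GoodAt` on `Fin N`. [folklore] -/
theorem isGappedTwelveAt_iff_goodAt (X : (N : ℕ) → (Fin N → E3)) (a : ℝ) (N : ℕ) (i : Fin N) :
    IsGappedTwelveAt X a N i ↔ GoodAt a (X N) i := Iff.rfl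

/-- **The witness sequence**: the mixture as soon as it is `κ`-near, a true ground state before. -/
def wit (κ : ℝ) (K M : ℕ) : Fin M → E3 :=
  if interactionEnergy lennardJones (mix K M) ≤ (1 - κ) * groundStateEnergy lennardJones 3 M
  then mix K M else gs M

end Summit.AtomisticToContinuum.Crystallization.Theorems.RadialDefectsVanish.Negative

end
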